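import Literature.Topology.Euclidean.LatticeCubeSkeleton
import Mathlib.Analysis.Calculus.ContDiff.Operations
import Mathlib.Topology.Order.Lattice
import HarnessLib

/-!
# Radial projection in a lattice face from an interior point ("pushing off a cell")

Topic `Literature/Topology/Euclidean`, continuing `LatticeCubeSkeleton.lean`. The basic move of
cellular approximation by general position (Hatcher, *Algebraic Topology* (2002), §4.1, proof of
Thm. 4.8, p. 350: once the image misses a point `p` of an open cell `eᵐ`, compose with the
radial projection of `ēᵐ ∖ {p}` onto `∂eᵐ`): for a lattice face `G` of `h ℤᴺ` and a point `p` of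
its relative interior,

* `LatticeCube.Face.gauge G h p v`: the gauge of the box `G - p` (a finite max of linear forms);
* `LatticeCube.Face.rpush G h p u = p + (gauge (u - p))⁻¹ • (u - p)`: the radial projection of
  `G ∖ {p}` onto `∂G`; it is the identity on `∂G`, continuous off `p`, and at each point agrees
  with one of the `2N` rational maps `LatticeCube.Face.rbranch G h p i b` (`C¹` off the
  hyperplane `uᵢ = pᵢ`) — the "branchwise `C¹`" property used with
  `Literature.Topology.Euclidean.IsC1Covered.image_of_branches`;
* `LatticeCube.rdom p i b`: the open half-spaces on which the branches are used
  (`LatticeCube.isOpen_rdom`, `LatticeCube.Face.contDiffOn_rbranch`).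

The extension of the push by the identity outside `G` (and its continuity on a skeleton minus
`p`) is in the sequel `LatticeCubePushSkel.lean`. No `sorry`; [folklore].

## References

* A. Hatcher, *Algebraic Topology*, CUP (2002), §4.1, proof of Thm. 4.8 (p. 350).
  [HatcherAT2002]
-/

noncomputable section

open Set Metric Topology Function

namespace Literature.Topology.Euclidean

namespace LatticeCube

variable {N : ℕ}

/-- The open half-spaces on which the branches are smooth. [folklore] -/
def rdom (p : Fin N → ℝ) (i : Fin N) (b : Bool) : Set (Fin N → ℝ) :=
  if b then {u | p i < u i} else {u | u i < p i}

namespace Face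

variable (G : Face N) (h : ℝ) (p : Fin N → ℝ)

/-! ### The gauge of a face seen from an interior point -/

/-- The coordinate gauge in direction `i`: `max (vᵢ / (hiᵢ - pᵢ)) (-vᵢ / (pᵢ - loᵢ))` with
`loᵢ = aᵢ h`, `hiᵢ = (aᵢ + 1) h`. [folklore] -/
def cgauge (i : Fin N) (v : Fin N → ℝ) : ℝ :=
  max (v i / (((G.a i : ℝ) + 1) * h - p i)) (-v i / (p i - (G.a i : ℝ) * h))

/-- **The gauge** of the translated face `G - p` (for `G.S` nonempty; `0` otherwise): the largest
coordinate gauge over the free directions. [folklore] -/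
def gauge (v : Fin N → ℝ) : ℝ :=
  if hS : G.S.Nonempty then G.S.sup' hS (fun i => G.cgauge h p i v) else 0

/-- **The radial push** from `p`: `u ↦ p + (gauge (u - p))⁻¹ • (u - p)`. [folklore] -/
def rpush (u : Fin N → ℝ) : Fin N → ℝ := p + (G.gauge h p (u - p))⁻¹ • (u - p)

/-- The rational branches of the radial push: scale `u - p` so that the `i`-th coordinate
reaches the upper (`b = true`) or lower (`b = false`) end of the face. [folklore] -/
def rbranch (i : Fin N) (b : Bool) (u : Fin N → ℝ) : Fin N → ℝ :=
  p + (((if b then ((G.a i : ℝ) + 1) * h else (G.a i : ℝ) * h) - p i) / (u i - p i)) • (u - p)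

variable {G h p}

/-- The coordinate gauge is continuous. [folklore] -/
theorem continuous_cgauge (i : Fin N) : Continuous (G.cgauge h p i) := by
  unfold cgauge; fun_prop

/-- The gauge is continuous. [folklore] -/
theorem continuous_gauge : Continuous (G.gauge h p) := by
  unfold gauge
  split_ifs with hS
  · exact Continuous.finset_sup'_apply hS fun i _ => continuous_cgauge i
  · exact continuous_const

/-- The coordinate gauge is positively homogeneous. [folklore] -/
theorem cgauge_smul (i : Fin N) {c : ℝ} (hc : 0 ≤ c) (v : Fin N → ℝ) :
    G.cgauge h p i (c • v) = c * G.cgauge h p i v := by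
  simp only [cgauge, Pi.smul_apply, smul_eq_mul]
  rw [mul_max_of_nonneg _ _ hc]
  congr 1 <;> ring

/-- The gauge is positively homogeneous. [folklore] -/
theorem gauge_smul {c : ℝ} (hc : 0 ≤ c) (v : Fin N → ℝ) :
    G.gauge h p (c • v) = c * G.gauge h p v := by
  unfold gauge
  split_ifs with hS
  · refine le_antisymm (Finset.sup'_le _ _ fun i hi => ?_) ?_
    · rw [cgauge_smul i hc]
      exact mul_le_mul_of_nonneg_left (Finset.le_sup' (fun i => G.cgauge h p i v) hi) hc
    · obtain ⟨i, hi, heq⟩ := Finset.exists_mem_eq_sup' hS (fun i => G.cgauge h p i v)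
      rw [heq, ← cgauge_smul i hc]
      exact Finset.le_sup' (fun i => G.cgauge h p i (c • v)) hi
  · ring

section Interior

variable (hp : p ∈ G.relint h)
include hp

/-- The upper margins `hiᵢ - pᵢ` are positive on free directions. [folklore] -/
theorem hi_sub_pos {i : Fin N} (hi : i ∈ G.S) : 0 < ((G.a i : ℝ) + 1) * h - p i := by
  linarith [((hp i).1 hi).2]

/-- The lower margins `pᵢ - loᵢ` are positive on free directions. [folklore] -/
theorem sub_lo_pos {i : Fin N} (hi : i ∈ G.S) : 0 < p i - (G.a i : ℝ) * h := by
  linarith [((hp i).1 hi).1]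

/-- Coordinate gauges are nonnegative (one of the two quotients is). [folklore] -/
theorem cgauge_nonneg {i : Fin N} (hi : i ∈ G.S) (v : Fin N → ℝ) : 0 ≤ G.cgauge h p i v := by
  unfold cgauge
  rcases le_total 0 (v i) with hv | hv
  · exact le_max_of_le_left (div_nonneg hv (hi_sub_pos hp hi).le)
  · exact le_max_of_le_right (div_nonneg (by linarith) (sub_lo_pos hp hi).le)

/-- A coordinate gauge vanishes only if the coordinate does. [folklore] -/
theorem cgauge_pos {i : Fin N} (hi : i ∈ G.S) {v : Fin N → ℝ} (hv : v i ≠ 0) :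
    0 < G.cgauge h p i v := by
  unfold cgauge
  rcases lt_or_gt_of_ne hv with hv | hv
  · exact lt_max_of_lt_right (div_pos (by linarith) (sub_lo_pos hp hi))
  · exact lt_max_of_lt_left (div_pos hv (hi_sub_pos hp hi))

/-- On the face, coordinate gauges of `u - p` are `≤ 1`. [folklore] -/
theorem cgauge_le_one {i : Fin N} (hi : i ∈ G.S) {u : Fin N → ℝ} (hu : u ∈ G.carrier h) :
    G.cgauge h p i (u - p) ≤ 1 := by
  have h1 := (hu i).1 hi
  unfold cgauge
  refine max_le ?_ ?_
  · rw [div_le_one (hi_sub_pos hp hi)]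
    simp only [Pi.sub_apply]; linarith [h1.2]
  · rw [div_le_one (sub_lo_pos hp hi)]
    simp only [Pi.sub_apply]; linarith [h1.1]

/-- A coordinate gauge of `u - p` equals `1` at an end of the interval. [folklore] -/
theorem cgauge_eq_one {i : Fin N} (hi : i ∈ G.S) {u : Fin N → ℝ} (hu : u ∈ G.carrier h)
    (hend : u i = (G.a i : ℝ) * h ∨ u i = ((G.a i : ℝ) + 1) * h) : G.cgauge h p i (u - p) = 1 := by
  refine le_antisymm (cgauge_le_one hp hi hu) ?_
  unfold cgauge
  rcases hend with hend | hend
  · refine le_max_of_le_right ?_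
    rw [le_div_iff₀ (sub_lo_pos hp hi)]
    simp only [Pi.sub_apply, hend]; linarith
  · refine le_max_of_le_left ?_
    rw [le_div_iff₀ (hi_sub_pos hp hi)]
    simp only [Pi.sub_apply, hend]; linarith

/-- On the face, `gauge (u - p) ≤ 1`. [folklore] -/
theorem gauge_le_one {u : Fin N → ℝ} (hu : u ∈ G.carrier h) : G.gauge h p (u - p) ≤ 1 := by
  unfold gauge
  split_ifs with hS
  · exact Finset.sup'_le _ _ fun i hi => cgauge_le_one hp hi hu
  · exact zero_le_one

/-- The gauge is nonnegative. [folklore] -/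
theorem gauge_nonneg (v : Fin N → ℝ) : 0 ≤ G.gauge h p v := by
  unfold gauge
  split_ifs with hS
  · obtain ⟨i, hi⟩ := hS
    exact (cgauge_nonneg hp hi v).trans (Finset.le_sup' (fun i => G.cgauge h p i v) hi)
  · exact le_rfl

/-- Points of the face differ from `p` only in free directions. [folklore] -/
theorem sub_apply_eq_zero_of_not_mem {u : Fin N → ℝ} (hu : u ∈ G.carrier h) {i : Fin N}
    (hi : i ∉ G.S) : (u - p) i = 0 := by
  simp only [Pi.sub_apply, (hu i).2 hi, (hp i).2 hi, sub_self]

/-- **Off `p`, the gauge is positive** on the face. [folklore] -/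
theorem gauge_pos {u : Fin N → ℝ} (hu : u ∈ G.carrier h) (hup : u ≠ p) : 0 < G.gauge h p (u - p) := by
  -- some free coordinate of `u - p` is nonzero
  obtain ⟨i, hi, hne⟩ : ∃ i ∈ G.S, (u - p) i ≠ 0 := by
    by_contra hcon
    push Not at hcon
    refine hup (funext fun i => ?_)
    by_cases hi : i ∈ G.S
    · have := hcon i hi
      simp only [Pi.sub_apply] at this
      linarith
    · have := sub_apply_eq_zero_of_not_mem hp hu hi
      simp only [Pi.sub_apply] at this
      linarith
  unfold gauge
  rw [dif_pos ⟨i, hi⟩]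
  exact (cgauge_pos hp hi hne).trans_le (Finset.le_sup' (fun i => G.cgauge h p i (u - p)) hi)

/-- **On the boundary of the face the gauge is `1`.** [folklore] -/
theorem gauge_eq_one {u : Fin N → ℝ} (hu : u ∈ G.carrier h) (hu' : u ∉ G.relint h) :
    G.gauge h p (u - p) = 1 := by
  obtain ⟨i, hi, up, hmem⟩ := G.exists_mem_carrier_bdFace hu hu'
  have hend : u i = (G.a i : ℝ) * h ∨ u i = ((G.a i : ℝ) + 1) * h := by
    have h1 := (hmem i).2 (by simp [bdFace_S])
    cases up
    · left; rw [h1, bdFace_a_self_false]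
    · right; rw [h1, bdFace_a_self_true]; push_cast; ring
  refine le_antisymm (gauge_le_one hp hu) ?_
  unfold gauge
  rw [dif_pos ⟨i, hi⟩, ← cgauge_eq_one hp hi hu hend]
  exact Finset.le_sup' (fun i => G.cgauge h p i (u - p)) hi

/-! ### The radial push -/

/-- **The push is the identity on the boundary of the face.** [folklore] -/
theorem rpush_of_not_mem_relint {u : Fin N → ℝ} (hu : u ∈ G.carrier h) (hu' : u ∉ G.relint h) :
    G.rpush h p u = u := by
  simp [rpush, gauge_eq_one hp hu hu']

/-- **The push lands in the face** (coordinatewise bounds from `cgauge ≤ gauge`). [folklore] -/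
theorem rpush_mem_carrier {u : Fin N → ℝ} (hu : u ∈ G.carrier h) (hup : u ≠ p) :
    G.rpush h p u ∈ G.carrier h := by
  have hμ := gauge_pos hp hu hup
  set μ := G.gauge h p (u - p) with hμdef
  intro i
  constructor
  · intro hi
    have hS : G.S.Nonempty := ⟨i, hi⟩
    have h1 : G.cgauge h p i (u - p) ≤ μ := by
      rw [hμdef, gauge, dif_pos hS]
      exact Finset.le_sup' (fun i => G.cgauge h p i (u - p)) hi
    have h2 : (u - p) i / (((G.a i : ℝ) + 1) * h - p i) ≤ μ := (le_max_left _ _).trans h1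
    have h3 : -(u - p) i / (p i - (G.a i : ℝ) * h) ≤ μ := (le_max_right _ _).trans h1
    rw [div_le_iff₀ (hi_sub_pos hp hi)] at h2
    rw [div_le_iff₀ (sub_lo_pos hp hi)] at h3
    simp only [rpush, Pi.add_apply, Pi.smul_apply, smul_eq_mul, Pi.sub_apply] at h2 h3 ⊢
    constructor
    · -- lower bound: `pᵢ + (uᵢ - pᵢ)/μ ≥ loᵢ`
      have : -(u i - p i) ≤ μ * (p i - (G.a i : ℝ) * h) := h3
      have h4 : (u i - p i) * μ⁻¹ ≥ -(p i - (G.a i : ℝ) * h) := by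
        rw [ge_iff_le, ← neg_le_neg_iff, neg_neg, ← neg_mul]
        calc -(u i - p i) * μ⁻¹ ≤ μ * (p i - (G.a i : ℝ) * h) * μ⁻¹ :=
              mul_le_mul_of_nonneg_right this (inv_nonneg.2 hμ.le)
          _ = p i - (G.a i : ℝ) * h := by field_simp
      nlinarith [h4]
    · have : u i - p i ≤ μ * (((G.a i : ℝ) + 1) * h - p i) := h2
      have h4 : (u i - p i) * μ⁻¹ ≤ ((G.a i : ℝ) + 1) * h - p i := by
        calc (u i - p i) * μ⁻¹ ≤ μ * (((G.a i : ℝ) + 1) * h - p i) * μ⁻¹ :=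
              mul_le_mul_of_nonneg_right this (inv_nonneg.2 hμ.le)
          _ = ((G.a i : ℝ) + 1) * h - p i := by field_simp
      nlinarith [h4]
  · intro hi
    have h0 := sub_apply_eq_zero_of_not_mem hp hu hi
    simp only [rpush, Pi.add_apply, Pi.smul_apply, smul_eq_mul, h0, mul_zero, add_zero]
    exact (hp i).2 hi

/-- **The push lands on the boundary of the face.** [folklore] -/
theorem rpush_not_mem_relint {u : Fin N → ℝ} (hu : u ∈ G.carrier h) (hup : u ≠ p) :
    G.rpush h p u ∉ G.relint h := by
  have hμ := gauge_pos hp hu hup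
  intro hrel
  -- the direction achieving the gauge hits an end of its interval
  have hS : G.S.Nonempty := by
    by_contra hS
    simp [gauge, hS] at hμ
  obtain ⟨i, hi, heq⟩ := Finset.exists_mem_eq_sup' hS (fun i => G.cgauge h p i (u - p))
  have hgi : G.gauge h p (u - p) = G.cgauge h p i (u - p) := by rw [gauge, dif_pos hS, heq]
  have h1 := (hrel i).1 hi
  simp only [rpush, Pi.add_apply, Pi.smul_apply, smul_eq_mul, Pi.sub_apply] at h1
  set μ := G.gauge h p (u - p) with hμdef
  -- `cgauge i (u - p) = μ`: one of the two quotients equals `μ`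
  rcases max_choice ((u - p) i / (((G.a i : ℝ) + 1) * h - p i))
    (-(u - p) i / (p i - (G.a i : ℝ) * h)) with hc | hc
  · have h2 : (u i - p i) / (((G.a i : ℝ) + 1) * h - p i) = μ := by
      rw [hgi]; exact hc.symm ▸ rfl
    have h3 : u i - p i = μ * (((G.a i : ℝ) + 1) * h - p i) := by
      rw [← h2, div_mul_cancel₀ _ (hi_sub_pos hp hi).ne']
    have h4 : p i + μ⁻¹ * (u i - p i) = ((G.a i : ℝ) + 1) * h := by
      rw [h3, ← mul_assoc, inv_mul_cancel₀ hμ.ne', one_mul]; ring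
    linarith [h1.2, h4]
  · have h2 : -(u i - p i) / (p i - (G.a i : ℝ) * h) = μ := by
      rw [hgi]; exact hc.symm ▸ rfl
    have h3 : -(u i - p i) = μ * (p i - (G.a i : ℝ) * h) := by
      rw [← h2, div_mul_cancel₀ _ (sub_lo_pos hp hi).ne']
    have h4 : p i + μ⁻¹ * (u i - p i) = (G.a i : ℝ) * h := by
      have : u i - p i = -(μ * (p i - (G.a i : ℝ) * h)) := by linarith
      rw [this, mul_neg, ← mul_assoc, inv_mul_cancel₀ hμ.ne', one_mul]; ring
    linarith [h1.1, h4]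

/-- **The push is continuous off `p`** on the face. [folklore] -/
theorem continuousOn_rpush : ContinuousOn (G.rpush h p) (G.carrier h \ {p}) := by
  have h1 : ContinuousOn (fun u => (G.gauge h p (u - p))⁻¹) (G.carrier h \ {p}) := by
    refine ContinuousOn.inv₀ ?_ ?_
    · exact (continuous_gauge.comp (continuous_id.sub continuous_const)).continuousOn
    · rintro u ⟨hu, hup⟩
      exact (gauge_pos hp hu hup).ne'
  show ContinuousOn (fun u => p + (G.gauge h p (u - p))⁻¹ • (u - p)) _
  exact continuousOn_const.add (h1.smul (continuousOn_id.sub continuousOn_const))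

/-- **Branchwise, the push is one of the rational maps `rbranch`**, on its open half-space.
[folklore] -/
theorem exists_rbranch_eq {u : Fin N → ℝ} (hu : u ∈ G.carrier h) (hup : u ≠ p) :
    ∃ (i : Fin N) (b : Bool), u ∈ rdom p i b ∧ G.rpush h p u = G.rbranch h p i b u := by
  have hμ := gauge_pos hp hu hup
  have hS : G.S.Nonempty := by
    by_contra hS
    simp [gauge, hS] at hμ
  obtain ⟨i, hi, heq⟩ := Finset.exists_mem_eq_sup' hS (fun i => G.cgauge h p i (u - p))
  have hgi : G.gauge h p (u - p) = G.cgauge h p i (u - p) := by rw [gauge, dif_pos hS, heq]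
  rcases max_choice ((u - p) i / (((G.a i : ℝ) + 1) * h - p i))
    (-(u - p) i / (p i - (G.a i : ℝ) * h)) with hc | hc
  · -- upper branch: `uᵢ > pᵢ`
    have hq : G.gauge h p (u - p) = (u i - p i) / (((G.a i : ℝ) + 1) * h - p i) := by
      rw [hgi]; exact hc
    have hpos : 0 < u i - p i := by
      have := hμ; rw [hq] at this
      exact (div_pos_iff_of_pos_right (hi_sub_pos hp hi)).1 this
    refine ⟨i, true, ?_, ?_⟩
    · show u ∈ (if true then {u : Fin N → ℝ | p i < u i} else {u | u i < p i})
      simp only [if_true, mem_setOf_eq]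
      linarith
    · simp only [rpush, rbranch, if_true, hq]
      rw [inv_div]
  · have hq : G.gauge h p (u - p) = -(u i - p i) / (p i - (G.a i : ℝ) * h) := by
      rw [hgi]; exact hc
    have hneg : u i - p i < 0 := by
      have := hμ; rw [hq] at this
      have := (div_pos_iff_of_pos_right (sub_lo_pos hp hi)).1 this
      linarith
    refine ⟨i, false, ?_, ?_⟩
    · show u ∈ (if false then {u : Fin N → ℝ | p i < u i} else {u | u i < p i})
      simp only [Bool.false_eq_true, if_false, mem_setOf_eq]
      linarith
    · simp only [rpush, rbranch, Bool.false_eq_true, if_false, hq]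
      congr 1
      rw [inv_div, div_neg, ← neg_div, neg_sub]

end Interior

/-- The branches are `C¹` on their domains (rational maps with nonvanishing denominator).
[folklore] -/
theorem contDiffOn_rbranch (i : Fin N) (b : Bool) :
    ContDiffOn ℝ 1 (G.rbranch h p i b) (rdom p i b) := by
  have hne : ∀ u ∈ rdom p i b, u i - p i ≠ 0 := by
    intro u hu
    unfold rdom at hu
    split_ifs at hu with hb
    · exact sub_ne_zero.2 (ne_of_gt hu)
    · exact sub_ne_zero.2 (ne_of_lt hu)
  unfold rbranch
  refine contDiffOn_const.add (ContDiffOn.smul (contDiffOn_const.div ?_ hne) ?_)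
  · exact ((contDiff_apply ℝ ℝ i).sub contDiff_const).contDiffOn
  · exact (contDiff_id.sub contDiff_const).contDiffOn

end Face

/-- The branch domains are open. [folklore] -/
theorem isOpen_rdom (p : Fin N → ℝ) (i : Fin N) (b : Bool) : IsOpen (rdom p i b) := by
  unfold rdom
  split_ifs
  · exact isOpen_lt continuous_const (continuous_apply i)
  · exact isOpen_lt (continuous_apply i) continuous_const

end LatticeCube

end Literature.Topology.Euclidean

end
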